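import Mathlib
import HarnessLib

/-!
# K1L_D (stmt-AnomalousDissipation-27980), W7 ENGINE (R-b) — THE HYPOCOERCIVITY PARAMETER `ε` AND THE UNIFORM SLOT FLOOR `κ₀`
# (pure real arithmetic; helper; `--supports stmt-AnomalousDissipation-27980 --as helper`)

The cell slot contraction `W7Cell.cell_slot_contraction` (p675459) contracts the energy over the covering slot by
`exp(−ε c² q τ′/27)` provided `ε` obeys the Young constraints (c1) `8εc² ≤ dmin`, (c2) `4εDmax² ≤ dmin`, (c3) `εc² ≤ dtwo`,
(c4) `32ε²c²D₀² ≤ d₀·dmin` and the cap (c5) `64·27·ε ≤ 7q·dmin·τ′²`.  In the near-class regime of the cubature cell problem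
(`k̃ = |K₀|/n ∈ [ν/Kb, 1/2]`, viscosity `ν ≤ 1`, window `NearIso … (νlo/(Λn²)) (νhiΛ/n²)`, `OddSmall … (νβ/n²)`) the numbers are
`dmin = dtwo = π²νlo/Λ`, `Dmax = 25π²ν(hiΛ + β/2)`, `d₀ = 4π²νlo k̃²/Λ`, `D₀ = 4π²ν(hiΛ + β/2)k̃²`, `τ′ = Mτ_j/ν` (`τ_j ≥ 40`), and the
covering slot (`HighLabelDecay.coupledUnshielded_quant`, constant `γ`) has `q ≥ γ/15`, `c² ≥ k̃²γ/216`.  This file fixes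
**`ε := min (min (dmin/(8c²)) (dmin/(4Dmax²))) (min (d₀/(4D₀²)) (7q·dmin·τ′²/1728))`** and proves:
* `floor_caps` — (c1)–(c5) hold for this `ε` (c4 because `32ε²c²D₀² = (8εc²)(4εD₀²) ≤ dmin·d₀`);
* **`floor_uniform`** — `κ₀ ≤ ε c² q τ′/27` with the `ν`-, `k̃`-, `n`-FREE constant
  `κ₀ = min (min b₁ b₂) (min b₃ b₄)` (explicit products of `lo, γ, M, 1/Kb², 1/Λ, 1/(hiΛ+β/2)²`; `kappa0_pos`).
So ONE covering slot per period contracts the energy by the fixed factor `e^{−κ₀}` — the heart of the `ν`-uniform rate.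
W7 assembly owner: prover ad-sawtooth-k1loc-p1 g11 (scalings of planner ad-ideate-p4 g13's memo `Lines/onelevel-W7-threemode.md` §3).
No definitions, no sorry.  NOT a proof of the crux / of AD; rung F-D1.A0. [cite: BedrossianCotiZelati2017, §2 (choice of the hypocoercivity parameters)] [problem: turb]
-/

set_option linter.dupNamespace false

namespace Summit.AnomalousDissipation.AnomalousDissipation.Theorems.SolenoidalFractalHomogenisation.LagrangianStep.W7Engine

open Real

/-- **(c1)–(c5) for the engine's `ε`.**  With `ε = min (min (dmin/(8c²)) (dmin/(4Dmax²))) (min (d₀/(4D₀²)) (7q·dmin·τ′²/1728))`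
(all ingredients positive, `dtwo = dmin`): `0 ≤ ε`, `8εc² ≤ dmin`, `4εDmax² ≤ dmin`, `εc² ≤ dmin`, `32ε²c²D₀² ≤ d₀·dmin`,
`64·27·ε ≤ 7q·dmin·τ′²`. [cite: BedrossianCotiZelati2017, §2 (choice of the hypocoercivity parameters)] -/
theorem floor_caps {ε dmin Dmax d0 D0 τ' q c : ℝ} (hdmin : 0 < dmin) (hDmax : 0 < Dmax) (hd0 : 0 < d0) (hD0 : 0 < D0)
    (hτ' : 0 < τ') (hq : 0 < q) (hc : 0 < c)
    (hε : ε = min (min (dmin / (8 * c ^ 2)) (dmin / (4 * Dmax ^ 2))) (min (d0 / (4 * D0 ^ 2)) (7 * q * dmin * τ' ^ 2 / 1728))) :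
    0 ≤ ε ∧ 8 * ε * c ^ 2 ≤ dmin ∧ 4 * ε * Dmax ^ 2 ≤ dmin ∧ ε * c ^ 2 ≤ dmin ∧
      32 * ε ^ 2 * c ^ 2 * D0 ^ 2 ≤ d0 * dmin ∧ 64 * 27 * ε ≤ 7 * q * dmin * τ' ^ 2 := by
  have h1 : ε ≤ dmin / (8 * c ^ 2) := by rw [hε]; exact (min_le_left _ _).trans (min_le_left _ _)
  have h2 : ε ≤ dmin / (4 * Dmax ^ 2) := by rw [hε]; exact (min_le_left _ _).trans (min_le_right _ _)
  have h3 : ε ≤ d0 / (4 * D0 ^ 2) := by rw [hε]; exact (min_le_right _ _).trans (min_le_left _ _)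
  have h4 : ε ≤ 7 * q * dmin * τ' ^ 2 / 1728 := by rw [hε]; exact (min_le_right _ _).trans (min_le_right _ _)
  have hε0 : 0 ≤ ε := by
    rw [hε]
    refine le_min (le_min ?_ ?_) (le_min ?_ ?_) <;> positivity
  have c1 : 8 * ε * c ^ 2 ≤ dmin := by
    have := (le_div_iff₀ (by positivity : (0:ℝ) < 8 * c ^ 2)).1 h1
    linarith
  have c2 : 4 * ε * Dmax ^ 2 ≤ dmin := by
    have := (le_div_iff₀ (by positivity : (0:ℝ) < 4 * Dmax ^ 2)).1 h2
    linarith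
  have c3 : ε * c ^ 2 ≤ dmin := by nlinarith [mul_nonneg hε0 (sq_nonneg c)]
  have c4a : 4 * ε * D0 ^ 2 ≤ d0 := by
    have := (le_div_iff₀ (by positivity : (0:ℝ) < 4 * D0 ^ 2)).1 h3
    linarith
  have c4 : 32 * ε ^ 2 * c ^ 2 * D0 ^ 2 ≤ d0 * dmin := by
    have e : 32 * ε ^ 2 * c ^ 2 * D0 ^ 2 = (4 * ε * D0 ^ 2) * (8 * ε * c ^ 2) := by ring
    rw [e]
    exact mul_le_mul c4a c1 (by positivity) hd0.le
  have c5 : 64 * 27 * ε ≤ 7 * q * dmin * τ' ^ 2 := by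
    have := (le_div_iff₀ (by norm_num : (0:ℝ) < 1728)).1 h4
    linarith
  exact ⟨hε0, c1, c2, c3, c4, c5⟩

/-- Cap 1 product: `(dmin/(8c²))·(c²qτ′/27) = π² lo q M τ_j/(216Λ)`. -/
theorem cap1_eq {ν lo Λ M τj q c dmin τ' : ℝ} (hν : 0 < ν) (hΛ : 0 < Λ) (hc : 0 < c)
    (hdmin : dmin = Real.pi ^ 2 * ν * lo / Λ) (hτ' : τ' = M * τj / ν) :
    dmin / (8 * c ^ 2) * (c ^ 2 * q * τ' / 27) = Real.pi ^ 2 * lo * q * M * τj / (216 * Λ) := by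
  rw [hdmin, hτ']; field_simp; ring

/-- Cap 2 product: `(dmin/(4Dmax²))·(c²qτ′/27) = lo (c²/ν²) q M τ_j/(108·625 π² Λ (hiΛ+β/2)²)`. -/
theorem cap2_eq {ν lo hi Λ β M τj q c dmin Dmax τ' : ℝ} (hν : 0 < ν) (hΛ : 0 < Λ)
    (hdmin : dmin = Real.pi ^ 2 * ν * lo / Λ) (hDmax : Dmax = 25 * Real.pi ^ 2 * ν * (hi * Λ + β / 2)) (hτ' : τ' = M * τj / ν) :
    dmin / (4 * Dmax ^ 2) * (c ^ 2 * q * τ' / 27)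
      = lo * (c ^ 2 / ν ^ 2) * q * M * τj / (108 * 625 * Real.pi ^ 2 * Λ * (hi * Λ + β / 2) ^ 2) := by
  have hπ : 0 < Real.pi := Real.pi_pos
  rw [hdmin, hDmax, hτ']; field_simp; ring

/-- Cap 3 product: `(d₀/(4D₀²))·(c²qτ′/27) = lo (c²/k̃²) q M τ_j/(432 π² Λ (hiΛ+β/2)²)·(1/ν²)`. -/
theorem cap3_eq {ν lo hi Λ β M τj q c kt d0 D0 τ' : ℝ} (hν : 0 < ν) (hΛ : 0 < Λ) (hkt : 0 < kt)
    (hd0 : d0 = 4 * Real.pi ^ 2 * ν * lo * kt ^ 2 / Λ) (hD0 : D0 = 4 * Real.pi ^ 2 * ν * (hi * Λ + β / 2) * kt ^ 2)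
    (hτ' : τ' = M * τj / ν) :
    d0 / (4 * D0 ^ 2) * (c ^ 2 * q * τ' / 27)
      = lo * (c ^ 2 / kt ^ 2) * q * M * τj / (432 * Real.pi ^ 2 * Λ * (hi * Λ + β / 2) ^ 2) * (1 / ν ^ 2) := by
  have hπ : 0 < Real.pi := Real.pi_pos
  rw [hd0, hD0, hτ']; field_simp; ring

/-- Cap 4 product: `(7q·dmin·τ′²/1728)·(c²qτ′/27) = 7π² lo q² M³ τ_j³ (c²/ν²)/(46656 Λ)`. -/
theorem cap4_eq {ν lo Λ M τj q c dmin τ' : ℝ} (hν : 0 < ν) (hΛ : 0 < Λ)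
    (hdmin : dmin = Real.pi ^ 2 * ν * lo / Λ) (hτ' : τ' = M * τj / ν) :
    7 * q * dmin * τ' ^ 2 / 1728 * (c ^ 2 * q * τ' / 27)
      = 7 * Real.pi ^ 2 * lo * q ^ 2 * M ^ 3 * τj ^ 3 * (c ^ 2 / ν ^ 2) / (46656 * Λ) := by
  rw [hdmin, hτ']; field_simp; ring

/-- The two `k̃`-cancellations: `γ/(216Kb²) ≤ c²/ν²` and `γ/216 ≤ c²/k̃²` from `c² ≥ k̃²γ/216`, `k̃ ≥ ν/Kb`. -/
theorem c_sq_cancel {ν Kb γ kt c : ℝ} (hν : 0 < ν) (hKb : 0 < Kb) (hγ : 0 < γ) (hkt : ν / Kb ≤ kt) (hkt0 : 0 < kt)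
    (hc2 : kt ^ 2 * γ / 216 ≤ c ^ 2) :
    γ / (216 * Kb ^ 2) ≤ c ^ 2 / ν ^ 2 ∧ γ / 216 ≤ c ^ 2 / kt ^ 2 := by
  constructor
  · rw [div_le_div_iff₀ (by positivity) (by positivity)]
    have h0 : ν ≤ Kb * kt := by rwa [div_le_iff₀' hKb] at hkt
    have h1 : ν ^ 2 ≤ Kb ^ 2 * kt ^ 2 := by
      rw [← mul_pow]; exact pow_le_pow_left₀ hν.le h0 2
    calc γ * ν ^ 2 ≤ γ * (Kb ^ 2 * kt ^ 2) := mul_le_mul_of_nonneg_left h1 hγ.le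
      _ = (kt ^ 2 * γ / 216) * (216 * Kb ^ 2) := by ring
      _ ≤ c ^ 2 * (216 * Kb ^ 2) := mul_le_mul_of_nonneg_right hc2 (by positivity)
  · rw [le_div_iff₀ (by positivity)]; linarith

/-- **THE UNIFORM SLOT FLOOR.**  In the near-class regime (`ν ≤ 1`, `ν/Kb ≤ k̃`, `τ_j ≥ 40`, `q ≥ γ/15`, `c² ≥ k̃²γ/216`) the
engine's `ε` gives `κ₀ ≤ ε·c²·q·τ′/27`, `κ₀ = min (min b₁ b₂) (min b₃ b₄)` free of `ν, k̃, n, q, c, τ_j` (the four caps of `ε` one by one: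
`ν` cancels against `τ′ = Mτ_j/ν`, `k̃` against `c² ≥ k̃²γ/216` and `k̃ ≥ ν/Kb`). [cite: BedrossianCotiZelati2017, §2 (choice of the hypocoercivity parameters)] -/
theorem floor_uniform {ν lo hi Λ β M Kb γ kt τj q c ε dmin Dmax d0 D0 τ' : ℝ}
    (hν : 0 < ν) (hν1 : ν ≤ 1) (hlo : 0 < lo) (hΛ : 1 ≤ Λ) (hhb : 0 < hi * Λ + β / 2) (hM : 0 < M)
    (hKb : 0 < Kb) (hγ : 0 < γ) (hkt : ν / Kb ≤ kt) (hkt0 : 0 < kt) (hτj : 40 ≤ τj) (hq : γ / 15 ≤ q) (hc : 0 < c)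
    (hc2 : kt ^ 2 * γ / 216 ≤ c ^ 2)
    (hdmin : dmin = Real.pi ^ 2 * ν * lo / Λ) (hDmax : Dmax = 25 * Real.pi ^ 2 * ν * (hi * Λ + β / 2))
    (hd0 : d0 = 4 * Real.pi ^ 2 * ν * lo * kt ^ 2 / Λ) (hD0 : D0 = 4 * Real.pi ^ 2 * ν * (hi * Λ + β / 2) * kt ^ 2)
    (hτ' : τ' = M * τj / ν)
    (hε : ε = min (min (dmin / (8 * c ^ 2)) (dmin / (4 * Dmax ^ 2))) (min (d0 / (4 * D0 ^ 2)) (7 * q * dmin * τ' ^ 2 / 1728))) :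
    min (min (Real.pi ^ 2 * lo * (γ / 15) * M * 40 / (216 * Λ))
          (lo * (γ / (216 * Kb ^ 2)) * (γ / 15) * M * 40 / (108 * 625 * Real.pi ^ 2 * Λ * (hi * Λ + β / 2) ^ 2)))
        (min (lo * (γ / 216) * (γ / 15) * M * 40 / (432 * Real.pi ^ 2 * Λ * (hi * Λ + β / 2) ^ 2))
          (7 * Real.pi ^ 2 * lo * (γ / 15) ^ 2 * M ^ 3 * 40 ^ 3 * (γ / (216 * Kb ^ 2)) / (46656 * Λ)))
      ≤ ε * c ^ 2 * q * τ' / 27 := by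
  have hΛ0 : 0 < Λ := by linarith
  have hq0 : 0 < q := lt_of_lt_of_le (by positivity) hq
  have hτj0 : 0 < τj := by linarith
  have hτ'0 : 0 < τ' := by rw [hτ']; positivity
  have hX : 0 ≤ c ^ 2 * q * τ' / 27 := by positivity
  obtain ⟨hcν, hck⟩ := c_sq_cancel hν hKb hγ hkt hkt0 hc2
  have hγ15 : 0 ≤ γ / 15 := by positivity
  -- `ε·X = min of the four cap products`
  have hsplit : ε * c ^ 2 * q * τ' / 27 = min (min (dmin / (8 * c ^ 2) * (c ^ 2 * q * τ' / 27))
      (dmin / (4 * Dmax ^ 2) * (c ^ 2 * q * τ' / 27)))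
      (min (d0 / (4 * D0 ^ 2) * (c ^ 2 * q * τ' / 27)) (7 * q * dmin * τ' ^ 2 / 1728 * (c ^ 2 * q * τ' / 27))) := by
    have e : ε * c ^ 2 * q * τ' / 27 = ε * (c ^ 2 * q * τ' / 27) := by ring
    rw [e, hε, min_mul_of_nonneg _ _ hX, min_mul_of_nonneg _ _ hX, min_mul_of_nonneg _ _ hX]
  rw [hsplit, cap1_eq hν hΛ0 hc hdmin hτ', cap2_eq hν hΛ0 hdmin hDmax hτ', cap3_eq hν hΛ0 hkt0 hd0 hD0 hτ',
    cap4_eq hν hΛ0 hdmin hτ']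
  have hν2 : 1 ≤ 1 / ν ^ 2 := by
    rw [le_div_iff₀ (by positivity), one_mul]
    calc ν ^ 2 ≤ 1 ^ 2 := pow_le_pow_left₀ hν.le hν1 2
      _ = 1 := one_pow 2
  refine min_le_min (min_le_min ?_ ?_) (min_le_min ?_ ?_)
  · gcongr
  · gcongr
  · calc lo * (γ / 216) * (γ / 15) * M * 40 / (432 * Real.pi ^ 2 * Λ * (hi * Λ + β / 2) ^ 2)
        = lo * (γ / 216) * (γ / 15) * M * 40 / (432 * Real.pi ^ 2 * Λ * (hi * Λ + β / 2) ^ 2) * 1 := (mul_one _).symm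
      _ ≤ lo * (c ^ 2 / kt ^ 2) * q * M * τj / (432 * Real.pi ^ 2 * Λ * (hi * Λ + β / 2) ^ 2) * (1 / ν ^ 2) := by
          gcongr
  · gcongr

/-- The uniform floor constant is positive. -/
theorem kappa0_pos {lo hi Λ β M Kb γ : ℝ} (hlo : 0 < lo) (hΛ : 1 ≤ Λ) (hhb : 0 < hi * Λ + β / 2) (hM : 0 < M)
    (hKb : 0 < Kb) (hγ : 0 < γ) :
    0 < min (min (Real.pi ^ 2 * lo * (γ / 15) * M * 40 / (216 * Λ))
          (lo * (γ / (216 * Kb ^ 2)) * (γ / 15) * M * 40 / (108 * 625 * Real.pi ^ 2 * Λ * (hi * Λ + β / 2) ^ 2)))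
        (min (lo * (γ / 216) * (γ / 15) * M * 40 / (432 * Real.pi ^ 2 * Λ * (hi * Λ + β / 2) ^ 2))
          (7 * Real.pi ^ 2 * lo * (γ / 15) ^ 2 * M ^ 3 * 40 ^ 3 * (γ / (216 * Kb ^ 2)) / (46656 * Λ))) := by
  have hΛ0 : 0 < Λ := by linarith
  refine lt_min (lt_min ?_ ?_) (lt_min ?_ ?_) <;> positivity

end Summit.AnomalousDissipation.AnomalousDissipation.Theorems.SolenoidalFractalHomogenisation.LagrangianStep.W7Engine
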